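import Literature.MathematicalPhysics.QuantumFieldTheory.Balaban1983to89.Node00.OpsYSectDCoords
import Literature.MathematicalPhysics.QuantumFieldTheory.Balaban1983to89.B9Thm312WholeStepFrom3131
import Literature.MathematicalPhysics.QuantumFieldTheory.Balaban1983to89.B9Thm312WholeRightStepFrom3131

/-!
# `Balaban1983to89.B9PerturbationSplitAtLetters` — [B9] (3.117), (3.120), (3.135): THE GAUGE-MODE SPLIT OF THE PERTURBATION OPERATORS Δ′_π AND
# Δ⁽²⁾_π AT node00-def-Y's LETTERS — the `split` fields of the N06 certificate's displayed perturbation schemas `Letters3131` (left split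
# Δ′_π = T_a + D·T_b) and `Letters3131R` (right split Δ′_π = T_a′ + T_b′·D\*) AS THEOREMS at the instance, with NAMED letters carrying print's
# small current factor `Δ(U)∘D_U` ∕ `D\*_U∘Δ(U)`

T. Bałaban, *Propagators for lattice gauge theories in a background field*, Commun. Math. Phys. **99** (1985) 389–434 [`Balaban1985BackgroundPropagators`,
"B9"].  statement-level skeleton of published theorems with citation tags; proofs where landed; nothing here is a claim about the Yang–Mills mass gap.
PDF held (`paper:balaban1985-cmp99-background-propagators`, journal page = PDF page + 388); pp. 419–423 read first-hand this generation.
THE PRINT.  p. 419, (3.117): *"⟨A − Dλ, Δ(A − Dλ)⟩ = ⟨A, ΔA⟩ − ⟨[error terms], J⟩ … almost invariance of the quadratic form, the error terms are small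
because the function J = D\*η⁻²Im ∂U is small, if U satisfies the condition (3.36)"*; (3.119)–(3.120): Δ_π and its correction Δ′_π, *"a small perturbation
of Δ"*; p. 421: *"It is easy to find estimates for the operator Δ′_π using Theorem 3.1 and the inequality (3.49), we have to be careful only with the third
term in the definition (3.120) of Δ′_π. One of the three derivatives there has to be applied either to an expression on the right, or on the left, of Δ′_π"*;
p. 422, (3.135): *"Δ⁽²⁾_π = Δ⁽²⁾ − DRG′D\*Δ⁽²⁾ − Δ⁽²⁾DG′RD\* + DRG′D\*Δ⁽²⁾DG′RD\*"*.
THE POINT.  def-Y's Sect.-D layer (`Node00.OpsYSectDE`) types Δ′_π(U) := Δ(U) − Δ_π(U) and records `deltaPiPrimeY_eq_expand : Δ′_π = DRG′D*Δ + ΔDG′RD* −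
DRG′D*ΔDG′RD*` (Δ = `hessY U` (3.10), D = `gradY U`, D\* = `divY U`, R = `RY`, G′ = `Gp`).  Regrouping — nothing else — exhibits in EVERY term one factor
`B := Δ(U)∘D_U` (`hessGradY`, the Hessian on a pure gauge mode) or `B† := D*_U∘Δ(U)` (`divHessY`): print's (3.117) current terms (kernel-checked as
order-zero stencils of size O(J) in the pub-balaban t4∕NE9 chain on ITS carriers — `B9Eq3117HessOpGaugeMode.equiv_hessOp_covDerivL2K`,
`B9Eq3117DivHessOpGaugeMode.equiv_covDivL2K_hessOp`; at def-Y's letters they VANISH at `U = 1`, `Node00.OpsYSectDE.hessY_one_comp_gradY_one`).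
* LEFT split (dag-n06-l `B9Thm312WholeStepFrom3131.Letters3131.split`, `Tpi = Ta + Dv ∘ Tb`): **Δ′_π = [BG′RD\*] + D_U∘[RG′B† − RG′D\*BG′RD\*]**
  (`TaLY`, `TbLY`, `deltaPiPrimeY_eq_splitL`);
* RIGHT split (`B9Thm312WholeRightStepFrom3131.Letters3131R.splitR`, `Tpi = Ta′ + Tb′ ∘ Dvstar`): **Δ′_π = [D_URG′B†] + [BG′R − D_URG′D\*BG′R]∘D\*_U**
  (`TaRY`, `TbRY`, `deltaPiPrimeY_eq_splitR`);
* Δ⁽²⁾_π = π†Δ⁽²⁾π (π = 1 − D_UG′RD\*_U, def-Y `delta2PiY`) **= [Δ⁽²⁾π] + D_U∘[−RG′D\*Δ⁽²⁾π] = [π†Δ⁽²⁾] + [−π†Δ⁽²⁾D_UG′R]∘D\*_U** (`Ta2LY Tb2LY Ta2RY Tb2RY`,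
  `delta2PiY_eq_splitL ∕ _splitR`) — here the small factor is Δ⁽²⁾ itself ((3.137)).
§1 also records the `U = 1` faces (all eight letters vanish; for the Δ⁽²⁾ letters under `Δ⁽²⁾(1) = 0`); §2 transports the letters to n06-d's coordinate
carriers with def-Y's §5 scalings (`TaLcoK TbLcoKH …`, scaled `c⁻¹` like `TpicoK`; `DvcoKH ∕ DvscoKH` unscaled), proves ★★ `tpicoK_eq_splitL ∕ _splitR`,
`t2coK_eq_splitL ∕ _splitR` — the four `split` fields at the pinned models — and their `U = 1` faces; §3 reads them at a letter record `𝔬` under the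
certificate's pins (n06-d edition 17 `…V6EPairMX`'s `hTpico12 hT2co12 hDvco12 hDvsco12` shapes) and gives the two schemas FROM THEIR MAJORANT FIELDS ALONE
(★★ `letters3131_of_pins_of_maj`, `letters3131R_of_pins_of_maj`).
WHAT THIS GIVES THE CERTIFICATE (dag-n06-d, at leisure; no leaf name changes).  The eight free operator binders `Ta Ta₂ Tb Tb₂ Ta' Ta₂' Tb' Tb₂'` of
`hL3131 ∕ hL3131H ∕ hR3131` can be PINNED to the named models, the four `split` identities become theorems, and rows 20–21's displayed perturbation content
is then exactly the MAJORANTS `ta tb ta₂ tb₂` (+ `tbH tb₂H`, + the right twins) of NAMED operators each carrying `Δ(U)∘D_U`, `D*_U∘Δ(U)` or `Δ⁽²⁾(U)` —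
print's (3.131) ∕ (3.137), whose derivation from Theorem 3.1, (3.49), (3.36) is NOT typed here (at the instance: a carrier bridge to the pub-balaban chain's
(3.117) letters; a design note, not a claim).
HONEST SCOPE.  Finite-dimensional linear algebra (regrouping of def-Y's own expansion; n06-d's coordinate functor calculus); 0 `sorry`; no inequality of the
paper asserted; count-neutral; N06 NOT discharged; one finite lattice programme at fixed `ε` — nothing continuum ∕ ℝ⁴ ∕ OS ∕ mass gap ∕ Clay.  Cell `pub-ymgap`
(HUMAN RULING D-0062), Track A node N06 [B9], bundle F7 rows 20–21, seat `pub-ymgap-dag-n06-l` (g13), 2026-08-27.  NEW file; imports def-Y's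
`Node00.OpsYSectDCoords` and this lineage's two letter schemas BY NAME; declares nothing in `Node00.*`; nothing landed is modified.
-/

namespace Literature.MathematicalPhysics.QuantumFieldTheory.Balaban1983to89.B9PerturbationSplitAtLetters

open Node00 Node00.OpsYSectDCoords B9Thm312Whole B9Thm312WholeClasses
open B9Thm312WholeStepFrom3131 B9Thm312WholeRightStepFrom3131
open B6KLevelCensusIndexV1 (KIdx)
open B9CoReadingCoords B9CoReadingCoordsH B9CoReadingCoordsS
open B9Eq3132SectDLetters (gaugePiY gaugePiTY)
open B9Thm39ReadingCoords (cR39)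
open B11SectG (BlockNorm HasMaj)

noncomputable section

/-! ## §1 The letters at def-Y's Sect.-D layer: `B = Δ∘D_U`, `B† = D*∘Δ`, the eight split letters, the four split identities, the `U = 1` faces -/

section Letters

variable {𝔸 : Type} [NormedRing 𝔸] [NormedAlgebra ℂ 𝔸] [CompleteSpace 𝔸]
variable {d ℓ : ℕ} {hd : 1 ≤ d + 1} {hL : Odd (ℓ + 1) ∧ 1 < ℓ + 1} {b₀ b₁ : ℝ} (i : KIdx d ℓ hd hL b₀ b₁)

/-- **`B(U) := Δ(U) ∘ D_U` — THE HESSIAN (3.10) ON PURE GAUGE MODES**, print's (3.117) current term (*"the error terms are small because the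
function J … is small, if U satisfies the condition (3.36)"*); here only NAMED (def-Y's `hessY U ∘ₗ gradY U`), its smallness not asserted.
[cite: Balaban1985BackgroundPropagators, (3.117) p.419, (3.10) p.392, (3.3) p.390] -/
def hessGradY (U : CfgY 𝔸 i) : (SiteY i → 𝔸) →ₗ[ℂ] (FBondY i → 𝔸) := hessY i U ∘ₗ gradY i U

/-- **`B†(U) := D*_U ∘ Δ(U)`** — the transposed current term of (3.117) (p. 421: *"we apply the derivative D\* to A₁"*); NAMED only.
[cite: Balaban1985BackgroundPropagators, (3.117) p.419, (3.8) p.392, p.421] -/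
def divHessY (U : CfgY 𝔸 i) : (FBondY i → 𝔸) →ₗ[ℂ] (SiteY i → 𝔸) := divY i U ∘ₗ hessY i U

/-- **T_a := B∘G′RD\*** — the derivative-free part of the LEFT split of Δ′_π (the term ΔDG′RD\* of (3.120)'s expansion).
[cite: Balaban1985BackgroundPropagators, (3.120) p.419, (3.131) p.422] -/
def TaLY (parS : SiteParY 𝔸 i) (Gp : SiteOpY 𝔸 i) (U : CfgY 𝔸 i) : (FBondY i → 𝔸) →ₗ[ℂ] (FBondY i → 𝔸) :=
  hessGradY i U ∘ₗ Gp U ∘ₗ RY i parS Gp U ∘ₗ divY i U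

/-- **T_b := RG′B† − RG′D\*BG′RD\*** — the part of Δ′_π under the gauge-mode derivative D_U in the LEFT split (the terms DRG′D\*Δ and
−DRG′D\*ΔDG′RD\* of (3.120)'s expansion with the leading D_U factored out). [cite: Balaban1985BackgroundPropagators, (3.120) p.419, p.421, (3.131) p.422] -/
def TbLY (parS : SiteParY 𝔸 i) (Gp : SiteOpY 𝔸 i) (U : CfgY 𝔸 i) : (FBondY i → 𝔸) →ₗ[ℂ] (SiteY i → 𝔸) :=
  RY i parS Gp U ∘ₗ Gp U ∘ₗ divHessY i U
    - RY i parS Gp U ∘ₗ Gp U ∘ₗ divY i U ∘ₗ hessGradY i U ∘ₗ Gp U ∘ₗ RY i parS Gp U ∘ₗ divY i U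

/-- **T_a₂ := Δ⁽²⁾π**, π = 1 − D_UG′RD\*_U (def-Y ∕ n06-i `gaugePiY`) — the derivative-free part of the LEFT split of Δ⁽²⁾_π = π†Δ⁽²⁾π (3.135).
[cite: Balaban1985BackgroundPropagators, (3.135) p.422, (3.137) p.423] -/
def Ta2LY (parS : SiteParY 𝔸 i) (Gp : SiteOpY 𝔸 i) (Δ2 : BondOpY 𝔸 i) (U : CfgY 𝔸 i) : (FBondY i → 𝔸) →ₗ[ℂ] (FBondY i → 𝔸) :=
  Δ2 U ∘ₗ gaugePiY i parS Gp U

/-- **T_b₂ := −RG′D\*Δ⁽²⁾π** — the part of Δ⁽²⁾_π under D_U in the LEFT split. [cite: Balaban1985BackgroundPropagators, (3.135) p.422, (3.137) p.423] -/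
def Tb2LY (parS : SiteParY 𝔸 i) (Gp : SiteOpY 𝔸 i) (Δ2 : BondOpY 𝔸 i) (U : CfgY 𝔸 i) : (FBondY i → 𝔸) →ₗ[ℂ] (SiteY i → 𝔸) :=
  -(RY i parS Gp U ∘ₗ Gp U ∘ₗ divY i U ∘ₗ Δ2 U ∘ₗ gaugePiY i parS Gp U)

/-- **T_a′ := D_URG′B†** — the part of the RIGHT split of Δ′_π free of a trailing D\*_U (the term DRG′D\*Δ of (3.120)'s expansion).
[cite: Balaban1985BackgroundPropagators, (3.120) p.419, p.421, (3.131) p.422] -/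
def TaRY (parS : SiteParY 𝔸 i) (Gp : SiteOpY 𝔸 i) (U : CfgY 𝔸 i) : (FBondY i → 𝔸) →ₗ[ℂ] (FBondY i → 𝔸) :=
  gradY i U ∘ₗ RY i parS Gp U ∘ₗ Gp U ∘ₗ divHessY i U

/-- **T_b′ := BG′R − D_URG′D\*BG′R** — the part of Δ′_π before the trailing adjoint derivative D\*_U in the RIGHT split.
[cite: Balaban1985BackgroundPropagators, (3.120) p.419, p.421, (3.131) p.422; Balaban1984PropagatorsII, (2.26) p.228] -/
def TbRY (parS : SiteParY 𝔸 i) (Gp : SiteOpY 𝔸 i) (U : CfgY 𝔸 i) : (SiteY i → 𝔸) →ₗ[ℂ] (FBondY i → 𝔸) :=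
  hessGradY i U ∘ₗ Gp U ∘ₗ RY i parS Gp U
    - gradY i U ∘ₗ RY i parS Gp U ∘ₗ Gp U ∘ₗ divY i U ∘ₗ hessGradY i U ∘ₗ Gp U ∘ₗ RY i parS Gp U

/-- **T_a₂′ := π†Δ⁽²⁾**, π† = 1 − D_URG′D\*_U (`gaugePiTY`) — the RIGHT split of Δ⁽²⁾_π, part free of a trailing D\*_U.
[cite: Balaban1985BackgroundPropagators, (3.135) p.422, (3.137) p.423] -/
def Ta2RY (parS : SiteParY 𝔸 i) (Gp : SiteOpY 𝔸 i) (Δ2 : BondOpY 𝔸 i) (U : CfgY 𝔸 i) : (FBondY i → 𝔸) →ₗ[ℂ] (FBondY i → 𝔸) :=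
  gaugePiTY i parS Gp U ∘ₗ Δ2 U

/-- **T_b₂′ := −π†Δ⁽²⁾D_UG′R** — the RIGHT split of Δ⁽²⁾_π, part before the trailing D\*_U. [cite: Balaban1985BackgroundPropagators, (3.135) p.422, (3.137) p.423] -/
def Tb2RY (parS : SiteParY 𝔸 i) (Gp : SiteOpY 𝔸 i) (Δ2 : BondOpY 𝔸 i) (U : CfgY 𝔸 i) : (SiteY i → 𝔸) →ₗ[ℂ] (FBondY i → 𝔸) :=
  -(gaugePiTY i parS Gp U ∘ₗ Δ2 U ∘ₗ gradY i U ∘ₗ Gp U ∘ₗ RY i parS Gp U)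

/-- ★ **THE LEFT SPLIT OF Δ′_π**: Δ′_π(U) = T_a(U) + D_U ∘ T_b(U) — def-Y's `deltaPiPrimeY_eq_expand` regrouped; every letter carries the
current factor `B = Δ∘D_U` or `B† = D*∘Δ`. [cite: Balaban1985BackgroundPropagators, (3.120) p.419, p.421, (3.131) p.422] -/
theorem deltaPiPrimeY_eq_splitL (parS : SiteParY 𝔸 i) (Gp : SiteOpY 𝔸 i) (U : CfgY 𝔸 i) :
    deltaPiPrimeY i parS Gp U = TaLY i parS Gp U + gradY i U ∘ₗ TbLY i parS Gp U := by
  rw [deltaPiPrimeY_eq_expand]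
  simp only [TaLY, TbLY, hessGradY, divHessY, LinearMap.comp_sub, LinearMap.comp_assoc]
  abel

/-- ★ **THE RIGHT SPLIT OF Δ′_π**: Δ′_π(U) = T_a′(U) + T_b′(U) ∘ D\*_U. [cite: Balaban1985BackgroundPropagators, (3.120) p.419, p.421, (3.131) p.422] -/
theorem deltaPiPrimeY_eq_splitR (parS : SiteParY 𝔸 i) (Gp : SiteOpY 𝔸 i) (U : CfgY 𝔸 i) :
    deltaPiPrimeY i parS Gp U = TaRY i parS Gp U + TbRY i parS Gp U ∘ₗ divY i U := by
  rw [deltaPiPrimeY_eq_expand]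
  simp only [TaRY, TbRY, hessGradY, divHessY, LinearMap.sub_comp, LinearMap.comp_assoc]
  abel

/-- ★ **THE LEFT SPLIT OF Δ⁽²⁾_π**: π†Δ⁽²⁾π = Δ⁽²⁾π + D_U ∘ (−RG′D\*Δ⁽²⁾π). [cite: Balaban1985BackgroundPropagators, (3.135) p.422, (3.137) p.423] -/
theorem delta2PiY_eq_splitL (parS : SiteParY 𝔸 i) (Gp : SiteOpY 𝔸 i) (Δ2 : BondOpY 𝔸 i) (U : CfgY 𝔸 i) :
    delta2PiY i parS Gp Δ2 U = Ta2LY i parS Gp Δ2 U + gradY i U ∘ₗ Tb2LY i parS Gp Δ2 U := by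
  simp only [delta2PiY, Ta2LY, Tb2LY, gaugePiTY, LinearMap.sub_comp, LinearMap.id_comp, LinearMap.comp_neg, LinearMap.comp_assoc]
  abel

/-- ★ **THE RIGHT SPLIT OF Δ⁽²⁾_π**: π†Δ⁽²⁾π = π†Δ⁽²⁾ + (−π†Δ⁽²⁾D_UG′R) ∘ D\*_U. [cite: Balaban1985BackgroundPropagators, (3.135) p.422, (3.137) p.423] -/
theorem delta2PiY_eq_splitR (parS : SiteParY 𝔸 i) (Gp : SiteOpY 𝔸 i) (Δ2 : BondOpY 𝔸 i) (U : CfgY 𝔸 i) :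
    delta2PiY i parS Gp Δ2 U = Ta2RY i parS Gp Δ2 U + Tb2RY i parS Gp Δ2 U ∘ₗ divY i U := by
  simp only [delta2PiY, Ta2RY, Tb2RY, gaugePiY, LinearMap.comp_sub, LinearMap.comp_id, LinearMap.neg_comp, LinearMap.comp_assoc]
  abel

/-- at `U = 1`: `B(1) = Δ(1)∘D_1 = 0` (def-Y `hessY_one_comp_gradY_one`; print: J = 0 at the trivial background).
[cite: Balaban1985BackgroundPropagators, (3.117) p.419, (3.10) p.392, Cor. 3.5 p.407] -/
theorem hessGradY_one : hessGradY (𝔸 := 𝔸) i (fun _ _ => 1) = 0 := hessY_one_comp_gradY_one i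

/-- at `U = 1`: `B†(1) = D*_1∘Δ(1) = 0` (def-Y `divY_one_comp_hessY_one`). [cite: Balaban1985BackgroundPropagators, (3.117) p.419, (3.10) p.392, Cor. 3.5 p.407] -/
theorem divHessY_one : divHessY (𝔸 := 𝔸) i (fun _ _ => 1) = 0 := divY_one_comp_hessY_one i

/-- at `U = 1`: `T_a(1) = 0`. [cite: Balaban1985BackgroundPropagators, (3.120) p.419, Cor. 3.5 p.407] -/
theorem TaLY_one (parS : SiteParY 𝔸 i) (Gp : SiteOpY 𝔸 i) : TaLY i parS Gp (fun _ _ => 1) = 0 := by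
  rw [TaLY, hessGradY_one, LinearMap.zero_comp]

/-- at `U = 1`: `T_b(1) = 0`. [cite: Balaban1985BackgroundPropagators, (3.120) p.419, Cor. 3.5 p.407] -/
theorem TbLY_one (parS : SiteParY 𝔸 i) (Gp : SiteOpY 𝔸 i) : TbLY i parS Gp (fun _ _ => 1) = 0 := by
  simp only [TbLY, hessGradY_one, divHessY_one, LinearMap.zero_comp, LinearMap.comp_zero, sub_self]

/-- at `U = 1`: `T_a′(1) = 0`. [cite: Balaban1985BackgroundPropagators, (3.120) p.419, Cor. 3.5 p.407] -/
theorem TaRY_one (parS : SiteParY 𝔸 i) (Gp : SiteOpY 𝔸 i) : TaRY i parS Gp (fun _ _ => 1) = 0 := by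
  simp only [TaRY, divHessY_one, LinearMap.comp_zero]

/-- at `U = 1`: `T_b′(1) = 0`. [cite: Balaban1985BackgroundPropagators, (3.120) p.419, Cor. 3.5 p.407] -/
theorem TbRY_one (parS : SiteParY 𝔸 i) (Gp : SiteOpY 𝔸 i) : TbRY i parS Gp (fun _ _ => 1) = 0 := by
  simp only [TbRY, hessGradY_one, LinearMap.zero_comp, LinearMap.comp_zero, sub_self]

/-- at `U = 1`, for a residual letter with `Δ⁽²⁾(1) = 0`: `T_a₂(1) = 0`. [cite: Balaban1985BackgroundPropagators, (3.135) p.422, Cor. 3.5 p.407] -/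
theorem Ta2LY_one (parS : SiteParY 𝔸 i) (Gp : SiteOpY 𝔸 i) {Δ2 : BondOpY 𝔸 i} (hΔ : Δ2 (fun _ _ => 1) = 0) :
    Ta2LY i parS Gp Δ2 (fun _ _ => 1) = 0 := by
  rw [Ta2LY, hΔ, LinearMap.zero_comp]

/-- at `U = 1`, for a residual letter with `Δ⁽²⁾(1) = 0`: `T_b₂(1) = 0`. [cite: Balaban1985BackgroundPropagators, (3.135) p.422, Cor. 3.5 p.407] -/
theorem Tb2LY_one (parS : SiteParY 𝔸 i) (Gp : SiteOpY 𝔸 i) {Δ2 : BondOpY 𝔸 i} (hΔ : Δ2 (fun _ _ => 1) = 0) :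
    Tb2LY i parS Gp Δ2 (fun _ _ => 1) = 0 := by
  rw [Tb2LY, hΔ, LinearMap.zero_comp, LinearMap.comp_zero, LinearMap.comp_zero, LinearMap.comp_zero, neg_zero]

/-- at `U = 1`, for a residual letter with `Δ⁽²⁾(1) = 0`: `T_a₂′(1) = 0`. [cite: Balaban1985BackgroundPropagators, (3.135) p.422, Cor. 3.5 p.407] -/
theorem Ta2RY_one (parS : SiteParY 𝔸 i) (Gp : SiteOpY 𝔸 i) {Δ2 : BondOpY 𝔸 i} (hΔ : Δ2 (fun _ _ => 1) = 0) :
    Ta2RY i parS Gp Δ2 (fun _ _ => 1) = 0 := by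
  rw [Ta2RY, hΔ, LinearMap.comp_zero]

/-- at `U = 1`, for a residual letter with `Δ⁽²⁾(1) = 0`: `T_b₂′(1) = 0`. [cite: Balaban1985BackgroundPropagators, (3.135) p.422, Cor. 3.5 p.407] -/
theorem Tb2RY_one (parS : SiteParY 𝔸 i) (Gp : SiteOpY 𝔸 i) {Δ2 : BondOpY 𝔸 i} (hΔ : Δ2 (fun _ _ => 1) = 0) :
    Tb2RY i parS Gp Δ2 (fun _ _ => 1) = 0 := by
  rw [Tb2RY, hΔ, LinearMap.zero_comp, LinearMap.comp_zero, neg_zero]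

end Letters

/-! ## §2 In n06-d's coordinates, with def-Y's §5 scalings: the four `split` identities at the pinned models `TpicoK ∕ T2coK ∕ DvcoKH ∕ DvscoKH` -/

section Coords

variable {𝔸 : Type} [NormedRing 𝔸] [NormedAlgebra ℂ 𝔸] [CompleteSpace 𝔸] [FiniteDimensional ℝ 𝔸]
variable {κ : Type} [Fintype κ]
variable {d ℓ : ℕ} {hd : 1 ≤ d + 1} {hL : Odd (ℓ + 1) ∧ 1 < ℓ + 1} {b₀ b₁ : ℝ} (i : KIdx d ℓ hd hL b₀ b₁)
  (b : Module.Basis κ ℝ 𝔸) (B : B9.Backgrounds) (cfg : B.Cfg → CfgY 𝔸 i)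
  (parS : SiteParY 𝔸 i) (Gp : SiteOpY 𝔸 i) (Δ2 : BondOpY 𝔸 i)

/-- the model of `T_a(U)` on the bond-sector carrier, scaled `c⁻¹` (the scaling of `TpicoK`). [cite: Balaban1985BackgroundPropagators, (3.120)–(3.121) pp.419–420, (3.131) p.422] -/
def TaLcoK (U₁ : B.Cfg) : (XBK κ i → ℝ) →ₗ[ℝ] (XBK κ i → ℝ) :=
  (cR39 b)⁻¹ • coordOpK b (fun _ : Fin (d + 1) => (TaLY i parS Gp (cfg U₁)).restrictScalars ℝ)

/-- the model of `T_b(U)` (bonds → sites), scaled `c⁻¹` (`DvcoKH` is unscaled). [cite: Balaban1985BackgroundPropagators, (3.120)–(3.121) pp.419–420, (3.131) p.422] -/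
def TbLcoKH (U₁ : B.Cfg) : (XBK κ i → ℝ) →ₗ[ℝ] (XSK κ i → ℝ) :=
  (cR39 b)⁻¹ • coordOpKH b (fun _ : Fin (d + 1) => (TbLY i parS Gp (cfg U₁)).restrictScalars ℝ)

/-- the model of `T_a₂(U)`, scaled `c⁻¹` (the scaling of `T2coK`). [cite: Balaban1985BackgroundPropagators, (3.135) p.422, (3.137) p.423] -/
def Ta2LcoK (U₁ : B.Cfg) : (XBK κ i → ℝ) →ₗ[ℝ] (XBK κ i → ℝ) :=
  (cR39 b)⁻¹ • coordOpK b (fun _ : Fin (d + 1) => (Ta2LY i parS Gp Δ2 (cfg U₁)).restrictScalars ℝ)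

/-- the model of `T_b₂(U)` (bonds → sites), scaled `c⁻¹`. [cite: Balaban1985BackgroundPropagators, (3.135) p.422, (3.137) p.423] -/
def Tb2LcoKH (U₁ : B.Cfg) : (XBK κ i → ℝ) →ₗ[ℝ] (XSK κ i → ℝ) :=
  (cR39 b)⁻¹ • coordOpKH b (fun _ : Fin (d + 1) => (Tb2LY i parS Gp Δ2 (cfg U₁)).restrictScalars ℝ)

/-- the model of `T_a′(U)`, scaled `c⁻¹`. [cite: Balaban1985BackgroundPropagators, (3.120)–(3.121) pp.419–420, (3.131) p.422] -/
def TaRcoK (U₁ : B.Cfg) : (XBK κ i → ℝ) →ₗ[ℝ] (XBK κ i → ℝ) :=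
  (cR39 b)⁻¹ • coordOpK b (fun _ : Fin (d + 1) => (TaRY i parS Gp (cfg U₁)).restrictScalars ℝ)

/-- the model of `T_b′(U)` (sites → bonds), scaled `c⁻¹` (`DvscoKH` is unscaled). [cite: Balaban1985BackgroundPropagators, (3.120)–(3.121) pp.419–420, (3.131) p.422] -/
def TbRcoKH (U₁ : B.Cfg) : (XSK κ i → ℝ) →ₗ[ℝ] (XBK κ i → ℝ) :=
  (cR39 b)⁻¹ • coordOpKH b (fun _ : Fin (d + 1) => (TbRY i parS Gp (cfg U₁)).restrictScalars ℝ)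

/-- the model of `T_a₂′(U)`, scaled `c⁻¹`. [cite: Balaban1985BackgroundPropagators, (3.135) p.422, (3.137) p.423] -/
def Ta2RcoK (U₁ : B.Cfg) : (XBK κ i → ℝ) →ₗ[ℝ] (XBK κ i → ℝ) :=
  (cR39 b)⁻¹ • coordOpK b (fun _ : Fin (d + 1) => (Ta2RY i parS Gp Δ2 (cfg U₁)).restrictScalars ℝ)

/-- the model of `T_b₂′(U)` (sites → bonds), scaled `c⁻¹`. [cite: Balaban1985BackgroundPropagators, (3.135) p.422, (3.137) p.423] -/
def Tb2RcoKH (U₁ : B.Cfg) : (XSK κ i → ℝ) →ₗ[ℝ] (XBK κ i → ℝ) :=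
  (cR39 b)⁻¹ • coordOpKH b (fun _ : Fin (d + 1) => (Tb2RY i parS Gp Δ2 (cfg U₁)).restrictScalars ℝ)

/-- ★★ **`Letters3131.split` AT THE PINNED MODELS**: `TpicoK = TaLcoK + DvcoKH ∘ TbLcoKH` — def-Y's model of Δ′_π IS T_a + D·T_b in coordinates.
[cite: Balaban1985BackgroundPropagators, (3.120)–(3.121) pp.419–420, (3.131) p.422] -/
theorem tpicoK_eq_splitL (U₁ : B.Cfg) :
    TpicoK i b B cfg parS Gp U₁ = TaLcoK i b B cfg parS Gp U₁ + DvcoKH i b B cfg U₁ ∘ₗ TbLcoKH i b B cfg parS Gp U₁ := by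
  rw [TaLcoK, TbLcoKH, DvcoKH, LinearMap.comp_smul, coordOpKH_const_comp_coordOpKH_const, coordOpKH_eq_coordOpK, ← smul_add,
    ← coordOpK_const_add, TpicoK, deltaPiPrimeY_eq_splitL]
  rfl

/-- ★★ **`Letters3131.split₂` AT THE PINNED MODELS**: `T2coK = Ta2LcoK + DvcoKH ∘ Tb2LcoKH`. [cite: Balaban1985BackgroundPropagators, (3.135) p.422, (3.137) p.423] -/
theorem t2coK_eq_splitL (U₁ : B.Cfg) :
    T2coK i b B cfg parS Gp Δ2 U₁ = Ta2LcoK i b B cfg parS Gp Δ2 U₁ + DvcoKH i b B cfg U₁ ∘ₗ Tb2LcoKH i b B cfg parS Gp Δ2 U₁ := by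
  rw [Ta2LcoK, Tb2LcoKH, DvcoKH, LinearMap.comp_smul, coordOpKH_const_comp_coordOpKH_const, coordOpKH_eq_coordOpK, ← smul_add,
    ← coordOpK_const_add, T2coK, delta2PiY_eq_splitL]
  rfl

/-- ★★ **`Letters3131R.splitR` AT THE PINNED MODELS**: `TpicoK = TaRcoK + TbRcoKH ∘ DvscoKH` — def-Y's model of Δ′_π IS T_a′ + T_b′·D\* in coordinates.
[cite: Balaban1985BackgroundPropagators, (3.120)–(3.121) pp.419–420, (3.131) p.422; Balaban1984PropagatorsII, (2.26) p.228] -/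
theorem tpicoK_eq_splitR (U₁ : B.Cfg) :
    TpicoK i b B cfg parS Gp U₁ = TaRcoK i b B cfg parS Gp U₁ + TbRcoKH i b B cfg parS Gp U₁ ∘ₗ DvscoKH i b B cfg U₁ := by
  rw [TaRcoK, TbRcoKH, DvscoKH, LinearMap.smul_comp, coordOpKH_const_comp_coordOpKH_const, coordOpKH_eq_coordOpK, ← smul_add,
    ← coordOpK_const_add, TpicoK, deltaPiPrimeY_eq_splitR]
  rfl

/-- ★★ **`Letters3131R.splitR₂` AT THE PINNED MODELS**: `T2coK = Ta2RcoK + Tb2RcoKH ∘ DvscoKH`. [cite: Balaban1985BackgroundPropagators, (3.135) p.422, (3.137) p.423] -/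
theorem t2coK_eq_splitR (U₁ : B.Cfg) :
    T2coK i b B cfg parS Gp Δ2 U₁ = Ta2RcoK i b B cfg parS Gp Δ2 U₁ + Tb2RcoKH i b B cfg parS Gp Δ2 U₁ ∘ₗ DvscoKH i b B cfg U₁ := by
  rw [Ta2RcoK, Tb2RcoKH, DvscoKH, LinearMap.smul_comp, coordOpKH_const_comp_coordOpKH_const, coordOpKH_eq_coordOpK, ← smul_add,
    ← coordOpK_const_add, T2coK, delta2PiY_eq_splitR]
  rfl

omit [CompleteSpace 𝔸] [FiniteDimensional ℝ 𝔸] in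
/-- the coordinate model of the zero family is zero (n06-h `B9PerturbationLettersAtOne.coordOpK_const_zero`, re-derived to keep the import
list short). [cite: Balaban1985BackgroundPropagators, (3.42) p.397, dictionary] -/
private theorem coordOpK_const_zero' {S D : Type} : coordOpK b (fun _ : D => (0 : (S → 𝔸) →ₗ[ℝ] (S → 𝔸))) = 0 := by
  have h := coordOpK_smul b (0 : ℝ) (fun _ : D => (0 : (S → 𝔸) →ₗ[ℝ] (S → 𝔸)))
  simpa only [smul_zero, zero_smul] using h

omit [CompleteSpace 𝔸] [FiniteDimensional ℝ 𝔸] in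
/-- the mixed coordinate model of the zero family is zero. [cite: Balaban1985BackgroundPropagators, (3.126) p.420, dictionary] -/
private theorem coordOpKH_const_zero' {S S' D : Type} : coordOpKH b (fun _ : D => (0 : (S' → 𝔸) →ₗ[ℝ] (S → 𝔸))) = 0 := by
  have h := coordOpKH_smul b (0 : ℝ) (fun _ : D => (0 : (S' → 𝔸) →ₗ[ℝ] (S → 𝔸)))
  simpa only [smul_zero, zero_smul] using h

/-- at a configuration reading `1`: the model `TaLcoK` of T_a is `0` (the NAMED letters inhabit n06-h's `U = 1` face `letters3131_of_pins_one`).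
[cite: Balaban1985BackgroundPropagators, (3.120)–(3.121) pp.419–420, Cor. 3.5 p.407] -/
theorem taLcoK_eq_zero_of_cfg_one {U₁ : B.Cfg} (hU₁ : cfg U₁ = fun _ _ => 1) : TaLcoK i b B cfg parS Gp U₁ = 0 := by
  rw [TaLcoK, hU₁, TaLY_one, LinearMap.restrictScalars_zero, coordOpK_const_zero', smul_zero]

/-- at a configuration reading `1`: `TbLcoKH = 0`. [cite: Balaban1985BackgroundPropagators, (3.120)–(3.121) pp.419–420, Cor. 3.5 p.407] -/
theorem tbLcoKH_eq_zero_of_cfg_one {U₁ : B.Cfg} (hU₁ : cfg U₁ = fun _ _ => 1) : TbLcoKH i b B cfg parS Gp U₁ = 0 := by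
  rw [TbLcoKH, hU₁, TbLY_one, LinearMap.restrictScalars_zero, coordOpKH_const_zero', smul_zero]

/-- at a configuration reading `1`, residual letter with `Δ⁽²⁾(1) = 0`: `Ta2LcoK = 0`. [cite: Balaban1985BackgroundPropagators, (3.135) p.422, Cor. 3.5 p.407] -/
theorem ta2LcoK_eq_zero_of_cfg_one {U₁ : B.Cfg} (hU₁ : cfg U₁ = fun _ _ => 1) (hΔ : Δ2 (fun _ _ => 1) = 0) :
    Ta2LcoK i b B cfg parS Gp Δ2 U₁ = 0 := by
  rw [Ta2LcoK, hU₁, Ta2LY_one i parS Gp hΔ, LinearMap.restrictScalars_zero, coordOpK_const_zero', smul_zero]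

/-- at a configuration reading `1`, residual letter with `Δ⁽²⁾(1) = 0`: `Tb2LcoKH = 0`. [cite: Balaban1985BackgroundPropagators, (3.135) p.422, Cor. 3.5 p.407] -/
theorem tb2LcoKH_eq_zero_of_cfg_one {U₁ : B.Cfg} (hU₁ : cfg U₁ = fun _ _ => 1) (hΔ : Δ2 (fun _ _ => 1) = 0) :
    Tb2LcoKH i b B cfg parS Gp Δ2 U₁ = 0 := by
  rw [Tb2LcoKH, hU₁, Tb2LY_one i parS Gp hΔ, LinearMap.restrictScalars_zero, coordOpKH_const_zero', smul_zero]

/-- at a configuration reading `1`: `TaRcoK = 0`. [cite: Balaban1985BackgroundPropagators, (3.120)–(3.121) pp.419–420, Cor. 3.5 p.407] -/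
theorem taRcoK_eq_zero_of_cfg_one {U₁ : B.Cfg} (hU₁ : cfg U₁ = fun _ _ => 1) : TaRcoK i b B cfg parS Gp U₁ = 0 := by
  rw [TaRcoK, hU₁, TaRY_one, LinearMap.restrictScalars_zero, coordOpK_const_zero', smul_zero]

/-- at a configuration reading `1`: `TbRcoKH = 0`. [cite: Balaban1985BackgroundPropagators, (3.120)–(3.121) pp.419–420, Cor. 3.5 p.407] -/
theorem tbRcoKH_eq_zero_of_cfg_one {U₁ : B.Cfg} (hU₁ : cfg U₁ = fun _ _ => 1) : TbRcoKH i b B cfg parS Gp U₁ = 0 := by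
  rw [TbRcoKH, hU₁, TbRY_one, LinearMap.restrictScalars_zero, coordOpKH_const_zero', smul_zero]

/-- at a configuration reading `1`, residual letter with `Δ⁽²⁾(1) = 0`: `Ta2RcoK = 0`. [cite: Balaban1985BackgroundPropagators, (3.135) p.422, Cor. 3.5 p.407] -/
theorem ta2RcoK_eq_zero_of_cfg_one {U₁ : B.Cfg} (hU₁ : cfg U₁ = fun _ _ => 1) (hΔ : Δ2 (fun _ _ => 1) = 0) :
    Ta2RcoK i b B cfg parS Gp Δ2 U₁ = 0 := by
  rw [Ta2RcoK, hU₁, Ta2RY_one i parS Gp hΔ, LinearMap.restrictScalars_zero, coordOpK_const_zero', smul_zero]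

/-- at a configuration reading `1`, residual letter with `Δ⁽²⁾(1) = 0`: `Tb2RcoKH = 0`. [cite: Balaban1985BackgroundPropagators, (3.135) p.422, Cor. 3.5 p.407] -/
theorem tb2RcoKH_eq_zero_of_cfg_one {U₁ : B.Cfg} (hU₁ : cfg U₁ = fun _ _ => 1) (hΔ : Δ2 (fun _ _ => 1) = 0) :
    Tb2RcoKH i b B cfg parS Gp Δ2 U₁ = 0 := by
  rw [Tb2RcoKH, hU₁, Tb2RY_one i parS Gp hΔ, LinearMap.restrictScalars_zero, coordOpKH_const_zero', smul_zero]

end Coords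

/-! ## §3 At a letter record `𝔬` pinned to the models: the splits, and the two schemas `Letters3131 ∕ Letters3131R` from their majorant fields alone -/

section Pins

variable {𝔸 : Type} [NormedRing 𝔸] [NormedAlgebra ℂ 𝔸] [CompleteSpace 𝔸] [FiniteDimensional ℝ 𝔸]
variable {κ : Type} [Fintype κ]
variable {d ℓ : ℕ} {hd : 1 ≤ d + 1} {hL : Odd (ℓ + 1) ∧ 1 < ℓ + 1} {b₀ b₁ : ℝ}
variable {g : B9.Geometry} [Fintype g.Site] {Y Z : Type}
variable {R₀ : ℝ} {H₀ : Prop}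

omit [Fintype g.Site] in
/-- **the left splits at a pinned letter record**: under the certificate's pins `Tpi ↦ TpicoK`, `T2 ↦ T2coK`, `Dv ↦ DvcoKH` (n06-d edition 17's
`hTpico12 ∕ hT2co12 ∕ hDvco12` shapes) the record's Δ′_π and Δ⁽²⁾_π split as `Ta + Dv∘Tb` with the named models.
[cite: Balaban1985BackgroundPropagators, (3.120)–(3.121) pp.419–420, (3.131) p.422, (3.135) p.422] -/
theorem tpi_t2_splitL_of_pins (i : KIdx d ℓ hd hL b₀ b₁) (b : Module.Basis κ ℝ 𝔸) (B : B9.Backgrounds) (cfg : B.Cfg → CfgY 𝔸 i)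
    (parS : SiteParY 𝔸 i) (Gp : SiteOpY 𝔸 i) (Δ2 : BondOpY 𝔸 i) (𝔬 : Ops g B (XBK κ i) Y Z (XSK κ i)) (U₁ : B.Cfg)
    (hTpi : 𝔬.Tpi U₁ = TpicoK i b B cfg parS Gp U₁) (hT2 : 𝔬.T2 U₁ = T2coK i b B cfg parS Gp Δ2 U₁) (hDv : 𝔬.Dv U₁ = DvcoKH i b B cfg U₁) :
    𝔬.Tpi U₁ = TaLcoK i b B cfg parS Gp U₁ + 𝔬.Dv U₁ ∘ₗ TbLcoKH i b B cfg parS Gp U₁ ∧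
      𝔬.T2 U₁ = Ta2LcoK i b B cfg parS Gp Δ2 U₁ + 𝔬.Dv U₁ ∘ₗ Tb2LcoKH i b B cfg parS Gp Δ2 U₁ := by
  rw [hTpi, hT2, hDv]
  exact ⟨tpicoK_eq_splitL i b B cfg parS Gp U₁, t2coK_eq_splitL i b B cfg parS Gp Δ2 U₁⟩

omit [Fintype g.Site] in
/-- **the right splits at a pinned letter record** (pins `Tpi ↦ TpicoK`, `T2 ↦ T2coK`, `Dvstar ↦ DvscoKH`).
[cite: Balaban1985BackgroundPropagators, (3.120)–(3.121) pp.419–420, (3.131) p.422, (3.135) p.422; Balaban1984PropagatorsII, (2.26) p.228] -/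
theorem tpi_t2_splitR_of_pins (i : KIdx d ℓ hd hL b₀ b₁) (b : Module.Basis κ ℝ 𝔸) (B : B9.Backgrounds) (cfg : B.Cfg → CfgY 𝔸 i)
    (parS : SiteParY 𝔸 i) (Gp : SiteOpY 𝔸 i) (Δ2 : BondOpY 𝔸 i) (𝔬 : Ops g B (XBK κ i) Y Z (XSK κ i)) (U₁ : B.Cfg)
    (hTpi : 𝔬.Tpi U₁ = TpicoK i b B cfg parS Gp U₁) (hT2 : 𝔬.T2 U₁ = T2coK i b B cfg parS Gp Δ2 U₁)
    (hDvs : 𝔬.Dvstar U₁ = DvscoKH i b B cfg U₁) :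
    𝔬.Tpi U₁ = TaRcoK i b B cfg parS Gp U₁ + TbRcoKH i b B cfg parS Gp U₁ ∘ₗ 𝔬.Dvstar U₁ ∧
      𝔬.T2 U₁ = Ta2RcoK i b B cfg parS Gp Δ2 U₁ + Tb2RcoKH i b B cfg parS Gp Δ2 U₁ ∘ₗ 𝔬.Dvstar U₁ := by
  rw [hTpi, hT2, hDvs]
  exact ⟨tpicoK_eq_splitR i b B cfg parS Gp U₁, t2coK_eq_splitR i b B cfg parS Gp Δ2 U₁⟩

/-- ★★ **`Letters3131` AT THE PINS FROM ITS FOUR MAJORANT FIELDS ALONE**: at a letter record pinned to def-Y's models (`hTpi hT2 hDv`), the left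
perturbation schema of rows 20–21 (dag-n06-l `B9Thm312WholeStepFrom3131.Letters3131`) with the NAMED letters `TaLcoK Ta2LcoK TbLcoKH Tb2LcoKH`
holds as soon as the four small local majorants `ta tb ta₂ tb₂` hold for them — the two `split` fields are theorems (`tpicoK_eq_splitL`,
`t2coK_eq_splitL`).  The majorants themselves (print's (3.131) ∕ (3.137): Theorem 3.1, (3.49), (3.36)) are the HYPOTHESES here, not asserted.
[cite: Balaban1985BackgroundPropagators, (3.130)–(3.131) pp.421–422, (3.135)–(3.137) pp.422–423, p.398 (remark after (3.47))] -/
theorem letters3131_of_pins_of_maj (i : KIdx d ℓ hd hL b₀ b₁) (b : Module.Basis κ ℝ 𝔸) (B : B9.Backgrounds) (cfg : B.Cfg → CfgY 𝔸 i)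
    (parS : SiteParY 𝔸 i) (Gp : SiteOpY 𝔸 i) (Δ2 : BondOpY 𝔸 i) (𝔬 : Ops g B (XBK κ i) Y Z (XSK κ i)) (U₁ : B.Cfg)
    (hTpi : 𝔬.Tpi U₁ = TpicoK i b B cfg parS Gp U₁) (hT2 : 𝔬.T2 U₁ = T2coK i b B cfg parS Gp Δ2 U₁) (hDv : 𝔬.Dv U₁ = DvcoKH i b B cfg U₁)
    {hlen : ∀ y : g.Site, 0 ≤ g.len y} {t δT : ℝ}
    (hta : HasMaj (cNorm R₀ H₀ 𝔬.blk hlen 2) (cNorm R₀ H₀ 𝔬.blk hlen 0) (TaLcoK i b B cfg parS Gp U₁)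
      (fun a a' => t * Real.exp (-(δT * g.dist a a'))))
    (htb : HasMaj (cNorm R₀ H₀ 𝔬.blk hlen 2) (cNorm R₀ H₀ 𝔬.blkW hlen 1) (TbLcoKH i b B cfg parS Gp U₁)
      (fun a a' => t * Real.exp (-(δT * g.dist a a'))))
    (hta₂ : HasMaj (cNorm R₀ H₀ 𝔬.blk hlen 2) (cNorm R₀ H₀ 𝔬.blk hlen 0) (Ta2LcoK i b B cfg parS Gp Δ2 U₁)
      (fun a a' => t * Real.exp (-(δT * g.dist a a'))))
    (htb₂ : HasMaj (cNorm R₀ H₀ 𝔬.blk hlen 2) (cNorm R₀ H₀ 𝔬.blkW hlen 1) (Tb2LcoKH i b B cfg parS Gp Δ2 U₁)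
      (fun a a' => t * Real.exp (-(δT * g.dist a a')))) :
    Letters3131 𝔬 (TaLcoK i b B cfg parS Gp) (Ta2LcoK i b B cfg parS Gp Δ2) (TbLcoKH i b B cfg parS Gp) (Tb2LcoKH i b B cfg parS Gp Δ2)
      R₀ H₀ hlen t δT U₁ :=
  have hs := tpi_t2_splitL_of_pins i b B cfg parS Gp Δ2 𝔬 U₁ hTpi hT2 hDv
  { split := hs.1
    split₂ := hs.2
    ta := hta
    tb := htb
    ta₂ := hta₂
    tb₂ := htb₂ }

/-- ★★ **`Letters3131R` AT THE PINS FROM ITS FOUR MAJORANT FIELDS ALONE** (pins `hTpi hT2 hDvs`; dag-n06-l `B9Thm312WholeRightStepFrom3131.Letters3131R`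
with the NAMED letters `TaRcoK Ta2RcoK TbRcoKH Tb2RcoKH`; `splitR ∕ splitR₂` by `tpicoK_eq_splitR ∕ t2coK_eq_splitR`).
[cite: Balaban1985BackgroundPropagators, (3.130)–(3.131) pp.421–422, (3.135)–(3.137) pp.422–423, p.398 (remark after (3.47)); Balaban1984PropagatorsII, (2.26) p.228] -/
theorem letters3131R_of_pins_of_maj (i : KIdx d ℓ hd hL b₀ b₁) (b : Module.Basis κ ℝ 𝔸) (B : B9.Backgrounds) (cfg : B.Cfg → CfgY 𝔸 i)
    (parS : SiteParY 𝔸 i) (Gp : SiteOpY 𝔸 i) (Δ2 : BondOpY 𝔸 i) (𝔬 : Ops g B (XBK κ i) Y Z (XSK κ i)) (U₁ : B.Cfg)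
    (hTpi : 𝔬.Tpi U₁ = TpicoK i b B cfg parS Gp U₁) (hT2 : 𝔬.T2 U₁ = T2coK i b B cfg parS Gp Δ2 U₁)
    (hDvs : 𝔬.Dvstar U₁ = DvscoKH i b B cfg U₁) {hlen : ∀ y : g.Site, 0 ≤ g.len y} {t δT : ℝ}
    (hta : HasMaj (cNorm R₀ H₀ 𝔬.blk hlen 2) (cNorm R₀ H₀ 𝔬.blk hlen 0) (TaRcoK i b B cfg parS Gp U₁)
      (fun a a' => t * Real.exp (-(δT * g.dist a a'))))
    (hta₂ : HasMaj (cNorm R₀ H₀ 𝔬.blk hlen 2) (cNorm R₀ H₀ 𝔬.blk hlen 0) (Ta2RcoK i b B cfg parS Gp Δ2 U₁)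
      (fun a a' => t * Real.exp (-(δT * g.dist a a'))))
    (htb : HasMaj (cNormR R₀ H₀ 𝔬.blkW hlen 0) (cNormR R₀ H₀ 𝔬.blk hlen 1) (TbRcoKH i b B cfg parS Gp U₁)
      (fun a a' => t * Real.exp (-(δT * g.dist a a'))))
    (htb₂ : HasMaj (cNormR R₀ H₀ 𝔬.blkW hlen 0) (cNormR R₀ H₀ 𝔬.blk hlen 1) (Tb2RcoKH i b B cfg parS Gp Δ2 U₁)
      (fun a a' => t * Real.exp (-(δT * g.dist a a')))) :
    Letters3131R 𝔬 (TaRcoK i b B cfg parS Gp) (Ta2RcoK i b B cfg parS Gp Δ2) (TbRcoKH i b B cfg parS Gp) (Tb2RcoKH i b B cfg parS Gp Δ2)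
      R₀ H₀ hlen t δT U₁ :=
  have hs := tpi_t2_splitR_of_pins i b B cfg parS Gp Δ2 𝔬 U₁ hTpi hT2 hDvs
  { splitR := hs.1
    splitR₂ := hs.2
    ta := hta
    ta₂ := hta₂
    tb := htb
    tb₂ := htb₂ }

end Pins

end

end Literature.MathematicalPhysics.QuantumFieldTheory.Balaban1983to89.B9PerturbationSplitAtLetters
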